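import Summits.BirchSwinnertonDyer.BirchSwinnertonDyer.Theorems.SignedLowerHalvesKobayashiUpperHalfLargeImage
import Summits.BirchSwinnertonDyer.Rank1Residual.X4.KimTamagawaDefect
import Summits.BirchSwinnertonDyer.Rank1Residual.Supersingular.SignedRankZero
import Literature.NumberTheory.EllipticCurves.Kim2026.ShaLengthStructure
import Literature.NumberTheory.EllipticCurves.Rank1Residual.PeriodUnitProofs
import HarnessLib

/-!
# Crux `KobayashiLowerHalfLargeImage` (item stmt-BirchSwinnertonDyer-19001), line `kurihara_rigidity` (reshape r2):
# its two Kurihara-side stubs READ IN ANALYTIC RANK `0` — the `≥` half of Kim's Conjecture 1.10 IS the upper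
# half of the `p`-part of BSD (hence PROVED on X7 ∧ Surj ∧ `p ≥ 5` ∧ `r_an = 0` from refereed inputs, by name),
# and the `≤` half IS the lower half (hence at `r_an = 0` the line's hard stub is the leaf's missing input itself)
# (cell `bsd-ssimc`, seat `bsd-line-slh-p1`, lead of the line)

HONEST FRAMING (D-0152): theorems only; every theorem is CONDITIONAL on displayed PUBLISHED named facts
(Kim AJM 2026 Thm 1.8 (6) in `∂`-currency = `Kim2026.kuriharaPartial_vanishingOrder_eq_padicValNat_sha_add_partialInfty_of_maninConstant`;
for §3 also Kobayashi 2003 Thm 4.1 / 1.2, B. D. Kim 2013 Cor 3.15, the period facts, modularity, GZK — the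
inputs of the landed upper-half theorem `X7.missingUpperBoundAt_rankZero_of_thm41_of_surj_of_five_le`) and on
a modular parametrisation datum `D` with `p ∤ c_D` and the period transfer (Kim's hypotheses, per pair);
nothing is closed or booked; BSD is not proved by any of this.

WHAT. Kim's clause (6) at vanishing order `0` reads `ord_p(δ̃_1) = ord_p #Ш(E)(p) + ∂^{(∞)}(δ̃)` with
`δ̃_1 = [0]⁺_f`, and in analytic rank `0`, `ord_p [0]⁺_f = ord_p(L(E,1)/Ω_E) = ord_p #Ш_an + ord_p ∏ c_ℓ`
(period transfer a `p`-adic unit, torsion prime to `p`). Hence, at an analytic-rank-`0` pair: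
* `kimTamagawaDefectGeAt_of_missingUpperBoundAt` — `ord_p #Ш ≤ ord_p #Ш_an` (`Typed.MissingUpperBoundAt`)
  ⟹ `X4.KimTamagawaDefectGeAt W p D.f` (`ord_p ∏ c_ℓ ≤ ∂^{(∞)}`); and conversely
  `missingUpperBoundAt_of_kimTamagawaDefectGeAt`;
* `kimTamagawaDefectLeAt_of_missingLowerBoundAt` — `ord_p #Ш_an ≤ ord_p #Ш` (`Typed.MissingLowerBoundAt`)
  ⟹ `X4.KimTamagawaDefectLeAt W p D.f` (the converse of the cell's `X4.missingLowerBoundAt_of_kimTamagawaDefectLe`);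
* §3: on the large-image corner of X7 at `p ≥ 5`, `r_an = 0`, the `≥` stub of line `kurihara_rigidity`
  (`stub_tamagawa_le_kuriharaPartialInfty_X7`, there read through `CastellaSano2026_sec2_tamagawaDefectGe_implicit_OPEN`)
  holds at the datum from REFEREED inputs by name (`X7.kimTamagawaDefectGeAt_of_analyticRank_eq_zero`), because
  the upper half is in the kernel there (`X7.missingUpperBoundAt_rankZero_of_thm41_of_surj_of_five_le`).
READING FOR THE PLANNER: at `r_an = 0` the hard stub `stub_kuriharaPartialInfty_le_tamagawa_X7` is EQUIVALENT
(modulo Kim (6)) to the leaf's own missing input `MissingLowerBoundAt` — the line does not shorten the rank-`0`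
rows; its content beyond the leaf's currency is at analytic rank `≥ 1` (where `∂^{(ord)}` is a Kurihara number
at a level with `ν(n) = rank`, not an `L`-value) and in being class-wide and conductor-blind.

References: [Kim2022StructureSelmer] Thm 1.9 (6), §1.4.3, §1.5.1, Conj 1.10; [Kobayashi2003] Thm 4.1, Thm 1.2;
[BDKim2013] Cor 3.15; [GreenbergVatsal2000] §3 Rem 3.4; [Miller2011LMS] Def 1.1.
-/

set_option autoImplicit false
-- the Theorems namespace of a single-conjunct summit repeats the summit name by design (D-0017)
set_option linter.dupNamespace false

noncomputable section

open scoped Classical MatrixGroups ModularForm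

open CongruenceSubgroup WeierstrassCurve Literature.NumberTheory.EllipticCurves
  Literature.NumberTheory.EllipticCurves.ModularForms
  Literature.NumberTheory.EllipticCurves.Rank1Residual
  Literature.NumberTheory.EllipticCurves.Rank1Residual.Typed
  Summit.BirchSwinnertonDyer.Rank1Residual.Supersingular
  Summit.BirchSwinnertonDyer.Rank1Residual.X4

namespace Summit.BirchSwinnertonDyer.BirchSwinnertonDyer.Theorems.KuriharaRigidity

variable (W : WeierstrassCurve ℚ) [W.IsElliptic] [W.IsGloballyMinimal] (p : ℕ) [hp : Fact p.Prime]

/-! ### §1 The level `1` in analytic rank `0`: `ord_p δ̃_1 = ord_p #Ш_an + ord_p ∏ c_ℓ` -/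

omit [W.IsGloballyMinimal] in
/-- **`L(E,1)/Ω_E = [0]⁺_f / u`** for a newform `f` of `W` and the period transfer `Ω(W) = u·Ω⁺_f`.
[cite: MazurTateTeitelbaum1986Invent, §I.8 (8.6)] [cite: GreenbergVatsal2000, §3, Remark 3.4] -/
theorem entireLFunction_one_div_realPeriodRat_eq {N : ℕ} [NeZero N] {f : CuspForm (Gamma0 N) 2}
    (hf : IsNewformOf W f) {u : ℚ} (hu : W.realPeriodRat = u * plusPeriod f) :
    W.entireLFunction 1 / (W.realPeriodRat : ℂ) = ((ratPlusSymbol f 0 / u : ℚ) : ℂ) := by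
  have hΩpos : 0 < W.realPeriodRat := W.realPeriodRat_pos_holds
  have hu0 : u ≠ 0 := by
    rintro rfl
    rw [Rat.cast_zero, zero_mul] at hu
    exact hΩpos.ne' hu
  have hper0 : plusPeriod f ≠ 0 := by
    intro h0
    rw [h0, mul_zero] at hu
    exact hΩpos.ne' hu
  have hΩ : (W.realPeriodRat : ℂ) ≠ 0 := by exact_mod_cast hΩpos.ne'
  rw [div_eq_iff hΩ, hf.entireLFunction_one_eq, hu]
  push_cast
  field_simp

omit [W.IsGloballyMinimal] in
/-- **In analytic rank `0`: `ord_p [0]⁺_f = ord_p #Ш_an + ord_p ∏ c_ℓ`** for a newform `f` of `W` with the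
period transfer `|u|_p = 1` and `E[p]` irreducible (torsion prime to `p`); here `#Ш_an = q` is the rational
with `shaAn W = q` supplied by `shaAn_eq_of_analyticRank_eq_zero`.
[cite: Kim2022StructureSelmer, §1.4.3 (PDF p. 7)] [cite: Miller2011LMS, Def. 1.1] -/
theorem padicValRat_ratPlusSymbol_zero_eq_of_analyticRank_eq_zero
    (hGZK : rank_eq_analyticRank_of_analyticRank_le_one) (hr : W.analyticRank = 0)
    (hirr : W.HasIrreducibleModPGaloisRep p) {N : ℕ} [NeZero N] {f : CuspForm (Gamma0 N) 2} (hf : IsNewformOf W f)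
    (hs0 : ratPlusSymbol f 0 ≠ 0) {u : ℚ} (hu1 : ‖(u : ℚ_[p])‖ = 1) (hu : W.realPeriodRat = u * plusPeriod f) :
    ∃ q : ℚ, shaAn W = (q : ℂ) ∧
      padicValRat p (ratPlusSymbol f 0) = padicValRat p q + padicValNat p W.tamagawaProduct := by
  have hu0 : u ≠ 0 := by
    rintro rfl
    simp at hu1
  set t : ℚ := ratPlusSymbol f 0 / u with ht_def
  have ht : W.entireLFunction 1 / (W.realPeriodRat : ℂ) = (t : ℂ) :=
    entireLFunction_one_div_realPeriodRat_eq W hf hu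
  have ht0 : t ≠ 0 := div_ne_zero hs0 hu0
  refine ⟨t * (W.torsionOrder : ℚ) ^ 2 / (W.tamagawaProduct : ℚ),
    shaAn_eq_of_analyticRank_eq_zero W hGZK hr ht, ?_⟩
  rw [padicValRat_shaAn_witness W p hirr ht0, ht_def, padicValRat.div hs0 hu0,
    padicValRat_eq_zero_of_norm_ratCast_eq_one hu1]
  ring

/-! ### §2 Kim's clause (6) at vanishing order `0` against the two halves of the `p`-part of BSD -/

section RankZero

/-- **Clause (6) at vanishing order `0`, in BSD currency**: in analytic rank `0`, at `p ≥ 5` with `ρ̄` onto, a Manin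
datum `D` and the period transfer, there are `d : ℕ` and a rational `q = #Ш_an` with `∂^{(∞)}(δ̃) = d` and
`ord_p #Ш_an + ord_p ∏ c_ℓ = ord_p #Ш(E)(p) + d` (both sides `= ord_p [0]⁺_f`). GRANTED `hKim6` (PUBLISHED) and
GZK. [cite: Kim2022StructureSelmer, Thm. 1.9 (6) (PDF p. 8), §1.4.3 and §1.5.1 (PDF p. 7)] [cite: Miller2011LMS, Def. 1.1] -/
theorem exists_partialInfty_eq_and_shaAn_of_analyticRank_eq_zero
    (hKim6 : Kim2026.kuriharaPartial_vanishingOrder_eq_padicValNat_sha_add_partialInfty_of_maninConstant)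
    (hGZK : rank_eq_analyticRank_of_analyticRank_le_one) (hmod : hasEntireLFunction_rat)
    (hp5 : 5 ≤ p) (hr : W.analyticRank = 0) (hsurj : W.HasSurjectiveModNGaloisRep p)
    {N : ℕ} [NeZero N] (D : ModularParametrizationData W N) (hc : ¬ (p : ℤ) ∣ D.maninConstant)
    (hper : ∃ u : ℚ, ‖(u : ℚ_[p])‖ = 1 ∧ W.realPeriodRat = u * plusPeriod D.f) :
    ∃ (d : ℕ) (q : ℚ), kuriharaPartialInfty W p D.f = d ∧ shaAn W = (q : ℂ) ∧
      padicValRat p q + padicValNat p W.tamagawaProduct =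
        (padicValNat p W.shaOrder : ℤ) + d := by
  have hL : W.entireLFunction 1 ≠ 0 := (W.analyticRank_eq_zero_iff_holds (hmod W)).mp hr
  obtain ⟨_, hfin⟩ := hGZK W (by rw [hr]; exact zero_le_one)
  haveI : Finite W.sha := hfin
  have hirr : W.HasIrreducibleModPGaloisRep p :=
    hasIrreducibleModPGaloisRep_of_hasSurjectiveModNGaloisRep W p hsurj
  have hf : IsNewformOf W D.f := D.isNewformOf
  obtain ⟨u, hu1, hu⟩ := hper
  -- `[0]⁺_f ≠ 0` and `p`-integral
  have hs0 : ratPlusSymbol D.f 0 ≠ 0 := by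
    intro h0
    apply hL
    rw [hf.entireLFunction_one_eq, h0]
    simp
  have hp2 : p ≠ 2 := by omega
  have hint : ¬ p ∣ (ratPlusSymbol D.f 0).den := by
    have h := hf.not_dvd_den_ratPlusSymbol_div hp2 hirr (n := 1) (Nat.coprime_one_left N) 0
    simpa using h
  -- `∂^{(0)} = ord_p [0]⁺_f < ∞`
  have h1 : kuriharaDivIndex W p D.f 1 = ((padicValRat p (ratPlusSymbol D.f 0)).toNat : ℕ∞) :=
    kuriharaDivIndex_one_eq W p D.f hint hs0
  have hv0 : 0 ≤ padicValRat p (ratPlusSymbol D.f 0) := by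
    unfold padicValRat
    rw [padicValNat.eq_zero_of_not_dvd hint]
    simp
  -- clause (6) at `ord(δ̃) = 0`
  obtain ⟨d, hd, hidx⟩ := Kim2026.exists_partialInfty_eq_and_kuriharaDivIndex_one_eq_of_lt_top W p hp5
    hsurj hfin D hc ⟨u, hu1, hu⟩ hKim6 (by rw [h1]; exact ENat.coe_lt_top _)
  rw [h1, Nat.cast_inj] at hidx
  -- `ord_p [0]⁺_f = ord_p #Ш_an + ord_p ∏ c_ℓ`
  obtain ⟨q, hq, hval⟩ :=
    padicValRat_ratPlusSymbol_zero_eq_of_analyticRank_eq_zero W p hGZK hr hirr hf hs0 hu1 hu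
  have hsha : padicValNat p (Nat.card (AddCommGroup.primaryComponent W.sha p)) =
      padicValNat p W.shaOrder := by
    unfold WeierstrassCurve.shaOrder
    exact padicValNat_card_addPrimaryComponent p
  refine ⟨d, q, hd, hq, ?_⟩
  have h2 : (padicValRat p (ratPlusSymbol D.f 0)) = ((padicValRat p (ratPlusSymbol D.f 0)).toNat : ℤ) :=
    (Int.toNat_of_nonneg hv0).symm
  rw [← hval, h2, hidx, ← hsha]
  push_cast
  ring

/-- **The `≥` half of Kim's Conjecture 1.10 IS the upper half of the `p`-part of BSD in analytic rank `0`**: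
`Typed.MissingUpperBoundAt W p` (`ord_p #Ш ≤ ord_p #Ш_an`) ⟹ `X4.KimTamagawaDefectGeAt W p D.f`
(`ord_p ∏ c_ℓ ≤ ∂^{(∞)}(δ̃)`), GRANTED Kim's clause (6) (`hKim6`, PUBLISHED) and GZK, at `p ≥ 5` with `ρ̄` onto and
a Manin datum with the period transfer. CONDITIONAL; class-agnostic (any reduction at `p`).
[cite: Kim2022StructureSelmer, Thm. 1.9 (6) and Conj. 1.10 (PDF p. 8)] [cite: Miller2011LMS, Def. 1.1] -/
theorem kimTamagawaDefectGeAt_of_missingUpperBoundAt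
    (hKim6 : Kim2026.kuriharaPartial_vanishingOrder_eq_padicValNat_sha_add_partialInfty_of_maninConstant)
    (hGZK : rank_eq_analyticRank_of_analyticRank_le_one) (hmod : hasEntireLFunction_rat)
    (hp5 : 5 ≤ p) (hr : W.analyticRank = 0) (hsurj : W.HasSurjectiveModNGaloisRep p)
    {N : ℕ} [NeZero N] (D : ModularParametrizationData W N) (hc : ¬ (p : ℤ) ∣ D.maninConstant)
    (hper : ∃ u : ℚ, ‖(u : ℚ_[p])‖ = 1 ∧ W.realPeriodRat = u * plusPeriod D.f)
    (hub : MissingUpperBoundAt W p) :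
    KimTamagawaDefectGeAt W p D.f := by
  obtain ⟨d, q, hd, hq, hval⟩ :=
    exists_partialInfty_eq_and_shaAn_of_analyticRank_eq_zero W p hKim6 hGZK hmod hp5 hr hsurj D hc hper
  obtain ⟨q', hq', hle⟩ := hub
  have hqq : q' = q := by exact_mod_cast hq'.symm.trans hq
  subst hqq
  have htd : padicValNat p W.tamagawaProduct ≤ d := by
    have : (padicValNat p W.tamagawaProduct : ℤ) ≤ d := by linarith
    exact_mod_cast this
  rw [KimTamagawaDefectGeAt, hd]
  exact_mod_cast htd

/-- **… and conversely**: `X4.KimTamagawaDefectGeAt W p D.f ⟹ Typed.MissingUpperBoundAt W p` in analytic rank `0`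
(same inputs). So at `r_an = 0` the `≥` stub of line `kurihara_rigidity` and the upper half of `BSD(E,p)` are
the same statement modulo Kim (6). CONDITIONAL.
[cite: Kim2022StructureSelmer, Thm. 1.9 (6) and Conj. 1.10 (PDF p. 8)] [cite: Miller2011LMS, Def. 1.1] -/
theorem missingUpperBoundAt_of_kimTamagawaDefectGeAt
    (hKim6 : Kim2026.kuriharaPartial_vanishingOrder_eq_padicValNat_sha_add_partialInfty_of_maninConstant)
    (hGZK : rank_eq_analyticRank_of_analyticRank_le_one) (hmod : hasEntireLFunction_rat)
    (hp5 : 5 ≤ p) (hr : W.analyticRank = 0) (hsurj : W.HasSurjectiveModNGaloisRep p)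
    {N : ℕ} [NeZero N] (D : ModularParametrizationData W N) (hc : ¬ (p : ℤ) ∣ D.maninConstant)
    (hper : ∃ u : ℚ, ‖(u : ℚ_[p])‖ = 1 ∧ W.realPeriodRat = u * plusPeriod D.f)
    (hge : KimTamagawaDefectGeAt W p D.f) :
    MissingUpperBoundAt W p := by
  obtain ⟨d, q, hd, hq, hval⟩ :=
    exists_partialInfty_eq_and_shaAn_of_analyticRank_eq_zero W p hKim6 hGZK hmod hp5 hr hsurj D hc hper
  rw [KimTamagawaDefectGeAt, hd] at hge
  have htd : padicValNat p W.tamagawaProduct ≤ d := by exact_mod_cast hge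
  refine ⟨q, hq, ?_⟩
  have : (padicValNat p W.tamagawaProduct : ℤ) ≤ d := by exact_mod_cast htd
  linarith

/-- **The `≤` half of Kim's Conjecture 1.10 FOLLOWS FROM the lower half of the `p`-part of BSD in analytic rank
`0`**: `Typed.MissingLowerBoundAt W p` (`ord_p #Ш_an ≤ ord_p #Ш`) ⟹ `X4.KimTamagawaDefectLeAt W p D.f`
(`∂^{(∞)}(δ̃) ≤ ord_p ∏ c_ℓ`) — the converse of the cell's `X4.missingLowerBoundAt_of_kimTamagawaDefectLe`. So at
`r_an = 0` the HARD stub of line `kurihara_rigidity` is the leaf's missing input itself (modulo Kim (6)): the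
line's new content lives at analytic rank `≥ 1` and in class-wideness. CONDITIONAL.
[cite: Kim2022StructureSelmer, Thm. 1.9 (6) and Conj. 1.10 (PDF p. 8)] [cite: Miller2011LMS, Def. 1.1] -/
theorem kimTamagawaDefectLeAt_of_missingLowerBoundAt
    (hKim6 : Kim2026.kuriharaPartial_vanishingOrder_eq_padicValNat_sha_add_partialInfty_of_maninConstant)
    (hGZK : rank_eq_analyticRank_of_analyticRank_le_one) (hmod : hasEntireLFunction_rat)
    (hp5 : 5 ≤ p) (hr : W.analyticRank = 0) (hsurj : W.HasSurjectiveModNGaloisRep p)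
    {N : ℕ} [NeZero N] (D : ModularParametrizationData W N) (hc : ¬ (p : ℤ) ∣ D.maninConstant)
    (hper : ∃ u : ℚ, ‖(u : ℚ_[p])‖ = 1 ∧ W.realPeriodRat = u * plusPeriod D.f)
    (hlb : MissingLowerBoundAt W p) :
    KimTamagawaDefectLeAt W p D.f := by
  obtain ⟨d, q, hd, hq, hval⟩ :=
    exists_partialInfty_eq_and_shaAn_of_analyticRank_eq_zero W p hKim6 hGZK hmod hp5 hr hsurj D hc hper
  obtain ⟨q', hq', hle⟩ := hlb
  have hqq : q' = q := by exact_mod_cast hq'.symm.trans hq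
  subst hqq
  have htd : d ≤ padicValNat p W.tamagawaProduct := by
    have : (d : ℤ) ≤ padicValNat p W.tamagawaProduct := by linarith
    exact_mod_cast this
  rw [KimTamagawaDefectLeAt, hd]
  exact_mod_cast htd

/-- **At `r_an = 0`, Kim's Conjecture 1.10 at the pair ⟺ the `p`-part of BSD's two halves** (modulo Kim (6)):
`X4.KimTamagawaDefectAt W p D.f ↔ MissingLowerBoundAt W p ∧ MissingUpperBoundAt W p`. CONDITIONAL.
[cite: Kim2022StructureSelmer, Thm. 1.9 (6) and Conj. 1.10 (PDF p. 8)] [cite: Miller2011LMS, Def. 1.1] -/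
theorem kimTamagawaDefectAt_iff_missing_halves_of_analyticRank_eq_zero
    (hKim6 : Kim2026.kuriharaPartial_vanishingOrder_eq_padicValNat_sha_add_partialInfty_of_maninConstant)
    (hGZK : rank_eq_analyticRank_of_analyticRank_le_one) (hmod : hasEntireLFunction_rat)
    (hp5 : 5 ≤ p) (hr : W.analyticRank = 0) (hsurj : W.HasSurjectiveModNGaloisRep p)
    {N : ℕ} [NeZero N] (D : ModularParametrizationData W N) (hc : ¬ (p : ℤ) ∣ D.maninConstant)
    (hper : ∃ u : ℚ, ‖(u : ℚ_[p])‖ = 1 ∧ W.realPeriodRat = u * plusPeriod D.f)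
    (hKimk : Kim2026.rankZero_le_padicValNat_sha_of_kuriharaNumber_ne_zero) :
    KimTamagawaDefectAt W p D.f ↔ MissingLowerBoundAt W p ∧ MissingUpperBoundAt W p := by
  rw [kimTamagawaDefectAt_iff]
  constructor
  · rintro ⟨hle, hge⟩
    exact ⟨missingLowerBoundAt_of_kimTamagawaDefectLe W p hKimk hGZK hmod hp5 hr hsurj D hc hper hle,
      missingUpperBoundAt_of_kimTamagawaDefectGeAt W p hKim6 hGZK hmod hp5 hr hsurj D hc hper hge⟩
  · rintro ⟨hlb, hub⟩
    exact ⟨kimTamagawaDefectLeAt_of_missingLowerBoundAt W p hKim6 hGZK hmod hp5 hr hsurj D hc hper hlb,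
      kimTamagawaDefectGeAt_of_missingUpperBoundAt W p hKim6 hGZK hmod hp5 hr hsurj D hc hper hub⟩

end RankZero

/-! ### §3 The large-image corner of X7 at `p ≥ 5`, `r_an = 0`: the `≥` stub from refereed inputs -/

/-- **The `≥` stub of line `kurihara_rigidity` holds at every analytic-rank-`0` pair of the large-image corner
of X7 (`p ≥ 5`, `ρ̄` onto), at any Manin datum with the period transfer, from REFEREED inputs by name**:
Kobayashi 2003 Thm 4.1 / 1.2 + B. D. Kim 2013 Cor 3.15 + period facts + modularity + GZK give the upper half
`ord_p #Ш ≤ ord_p #Ш_an` there (`X7.missingUpperBoundAt_rankZero_of_thm41_of_surj_of_five_le`, landed), and Kim's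
clause (6) turns it into `X4.KimTamagawaDefectGeAt W p D.f` (§2). No preprint. CONDITIONAL on the named facts;
closes nothing (the stub is class-wide and rank-free; this is its `r_an = 0` slice, per datum).
[cite: Kobayashi2003, Thm. 4.1 (p. 8) and Thm. 1.2] [cite: BDKim2013, Cor. 3.15 (p. 199)]
[cite: Kim2022StructureSelmer, Thm. 1.9 (6) and Conj. 1.10 (PDF p. 8)] [cite: Miller2011LMS, Def. 1.1] -/
theorem X7.kimTamagawaDefectGeAt_of_analyticRank_eq_zero
    (hKim6 : Kim2026.kuriharaPartial_vanishingOrder_eq_padicValNat_sha_add_partialInfty_of_maninConstant)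
    (h41 : Kobayashi2003.thm41_signedCharIdeal_divisibility)
    (h12 : Kobayashi2003.thm12_signedSelmerDual_finite_torsion)
    (hKim : BDKim2013.cor315_signedCharValue_rankZero)
    (h5 : realPeriodRat_eq_unit_mul_plusPeriod) (h3 : realPeriodRat_eq_unit_mul_plusPeriod_three)
    (hmodD : nonempty_modularParametrizationData) (hmod : hasEntireLFunction_rat)
    (hGZK : rank_eq_analyticRank_of_analyticRank_le_one)
    (hp5 : 5 ≤ p) (hX : ClassX7 W p) (hs : Surj W p) (hr : W.analyticRank = 0)
    {N : ℕ} [NeZero N] (D : ModularParametrizationData W N) (hc : ¬ (p : ℤ) ∣ D.maninConstant) :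
    KimTamagawaDefectGeAt W p D.f :=
  kimTamagawaDefectGeAt_of_missingUpperBoundAt W p hKim6 hGZK hmod hp5 hr hs D hc
    (h5 W p hp5 hX.1.1 (hasIrreducibleModPGaloisRep_of_hasSurjectiveModNGaloisRep W p hs) D.f
      D.isNewformOf)
    (X7.missingUpperBoundAt_rankZero_of_thm41_of_surj_of_five_le W p h41 h12 hKim h5 h3 hmodD hmod hGZK hp5
      hX hs hr)

end Summit.BirchSwinnertonDyer.BirchSwinnertonDyer.Theorems.KuriharaRigidity

end
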